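import Summits.QuantumFields.YangMills.Theorems.BalabanLadderNTClassicalShadowOrbitGauge
import Literature.MathematicalPhysics.QuantumFieldTheory.ActionDensityTimeReflection
import Literature.MathematicalPhysics.QuantumLattice.LatticeGaugeDLRSymmetry
import Literature.MathematicalPhysics.QuantumFieldTheory.StrongCouplingActivities
import HarnessLib

/-!
# Crux `NT` (stmt-QuantumFields-19353), stub `stub_refpkgT : RefPkgT`: THE CLASSICAL SHADOW, VII — covariance of the cube kernels
# under the TIME REFLECTION `Θ` (orientation-reversing lattice symmetry), discharging hypothesis (S) of the orbit test for reflections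

Helper file (`--supports stmt-QuantumFields-19353`) of the fleet lead prover of crux `NT` (unit `ym-spine-19353-p1`, GEN 14); sequel
of `…NTClassicalShadowOrbit[Gauge]` (p601276, p603177).

The tree has the covariance of the lattice Yang–Mills DLR kernels `ymSpecification` under EDGE RELABELLINGS preserving the boundary Wilson
action (`ymSpecification_map_relabelConfig`: translations, coordinate permutations) and under gauge transformations, and the time reflection
`Θ = cfgReflect` of CONFIGURATIONS (`(ΘU)(x,i) = U(θx,i)`, `(ΘU)(x,0) = U(θx − e₀, 0)⁻¹`, `θ(x₀, x⃗) = (−x₀, x⃗)`; Osterwalder–Seiler) with its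
corner-plaquette identities (`ActionDensityTimeReflection`).  `Θ` is NOT a pure relabelling (temporal links are inverted), so the orbit test's
symmetry hypothesis (S) for axis reflections was left open.  This file closes it:

* §1 `reflectEdge_reflectEdge` (the edge map of `Θ` is an involution), `plaquetteObs_cfgReflect_spatial` / `plaquetteObs_cfgReflect_temporal`
  (plaquette observables of `ΘU` are plaquette observables of `U` at the reflected plaquette — every base point, not only the origin),
  `plaquetteEdges_reflectPlaq`, **`wilsonBoundaryAction_cfgReflect`**: `S_{θΛ}(ΘU) = S_Λ(U)`;
* §2 `cfgReflect_glueWith` (Θ intertwines the gluing maps), `measurePreserving_reflectTransport` (the induced map `G^Λ → G^{θΛ}`, a relabelling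
  followed by inversion of the temporal coordinates, preserves product Haar measure), **`ymSpecification_map_cfgReflect`**:
  `(γ_Λ(·|η)).map Θ = γ_{θΛ}(·|Θη)`;
* §3 **`kerE_cfgReflect`**: `kerE^{Θη}_{β,θ-box}(F) = kerE^η_{β,box}(F ∘ Θ)` and, for a box and an exterior mapped to themselves
  (`(cubeEdges c b).map θ = cubeEdges c' b`, `Θη = η`), the orbit-test hypothesis (S): `kerE^η(F ∘ Θ) = kerE^η(F)`.
Every lattice symmetry of a box is a composite of translations, coordinate permutations and `Θ`, all now with kernel covariance in the tree.

HONEST FRAMING.  Measure-theoretic bookkeeping (Haar inversion invariance, `Measure.pi` transport, tilting commutes with push-forward) over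
tree definitions; no floor, not AF, not NT, not the seam, not the gap; not Clay.
-/

set_option autoImplicit false

noncomputable section

open MeasureTheory Filter Topology
open Literature.MathematicalPhysics.QuantumFieldTheory Literature.MathematicalPhysics.QuantumLattice
open Literature.Probability.LatticeModels
open Summit.QuantumFields.YangMills.Cruxes.OSLegsFromFemtoAndGap.DlrCollarTransfer

namespace Summit.QuantumFields.YangMills.Cruxes.NT.ClassicalShadow

/-! ## §1 The edge involution, plaquettes and the boundary Wilson action under `Θ` -/

section Geometry

/-- `θ` is additive up to the constant: `θ(x − y) = θx − θy + θ0`; concretely `θ(x − e₀) = θx + e₀`. [folklore] -/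
theorem siteReflect_sub_single_zero (x : Site 4) : siteReflect (x - Pi.single 0 1) = siteReflect x + Pi.single 0 1 := by
  funext k
  by_cases hk : k = 0
  · subst hk; simp; ring
  · simp [siteReflect_apply_of_ne _ hk, hk]

/-- The edge map of the time reflection is an involution. [folklore] -/
theorem reflectEdge_reflectEdge (e : Literature.MathematicalPhysics.QuantumLattice.ZdEdge 4) : reflectEdge (reflectEdge e) = e := by
  obtain ⟨x, i⟩ := e
  by_cases hi : i = 0
  · subst hi
    simp only [reflectEdge, ↓reduceIte, siteReflect_sub_single_zero, siteReflect_siteReflect, add_sub_cancel_right]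
  · simp only [reflectEdge, hi, ↓reduceIte, siteReflect_siteReflect]

/-- The edge map of the time reflection as an involution. [folklore] -/
theorem reflectEdge_involutive : Function.Involutive (reflectEdge) := reflectEdge_reflectEdge

variable {G : Type} [Group G]

/-- `Θ` reads every link through the reflected edge, inverting the temporal ones. [folklore] -/
theorem cfgReflect_apply (U : LGConfig 4 G) (e : Literature.MathematicalPhysics.QuantumLattice.ZdEdge 4) :
    cfgReflect U e = if e.2 = 0 then (U (reflectEdge e))⁻¹ else U (reflectEdge e) := rfl

variable {N : ℕ} (ρ : G →* Matrix (Fin N) (Fin N) ℂ)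

/-- **Spatial plaquettes under `Θ`**: for `i, j ≠ 0`, `Re tr ρ((ΘU)_{p_{ij}(x)}) = Re tr ρ(U_{p_{ij}(θx)})`. [folklore] -/
theorem plaquetteObs_cfgReflect_spatial {i j : Fin 4} (hi : i ≠ 0) (hj : j ≠ 0) (x : Site 4) (U : LGConfig 4 G) :
    plaquetteObs ρ x i j (cfgReflect U) = plaquetteObs ρ (siteReflect x) i j U := by
  unfold plaquetteObs plaquetteHolonomyZd
  simp only [cfgReflect, reflectEdge, hi, hj, ↓reduceIte, siteReflect_add_single_of_ne _ hi,
    siteReflect_add_single_of_ne _ hj]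

variable [TopologicalSpace G] [IsTopologicalGroup G] [CompactSpace G]

/-- **Temporal plaquettes under `Θ`**: for `j ≠ 0` and a continuous representation of the compact group,
`Re tr ρ((ΘU)_{p_{0j}(x)}) = Re tr ρ(U_{p_{0j}(θx − e₀)})` (the reflected holonomy is a conjugate of the inverse). [cite: OsterwalderSeiler1978, §2] -/
theorem plaquetteObs_cfgReflect_temporal (hρ : Continuous ρ) {j : Fin 4} (hj : j ≠ 0) (x : Site 4) (U : LGConfig 4 G) :
    plaquetteObs ρ x 0 j (cfgReflect U) = plaquetteObs ρ (siteReflect x - Pi.single 0 1) 0 j U := by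
  unfold plaquetteObs plaquetteHolonomyZd
  simp only [cfgReflect, reflectEdge, hj, ↓reduceIte, siteReflect_add_single_of_ne _ hj, siteReflect_add_single_zero,
    inv_inv, sub_add_cancel]
  set z : Site 4 := siteReflect x - Pi.single 0 1 with hz
  have e1 : siteReflect x + Pi.single j 1 - Pi.single 0 1 = z + Pi.single j 1 := by rw [hz]; abel
  rw [e1]
  set g : G := U (z, 0)
  set a : G := U (z, j)
  set bq : G := U (z + Pi.single j 1, 0)
  set c : G := U (siteReflect x, j)
  have h1 : g⁻¹ * a * bq * c⁻¹ = g⁻¹ * (g * c * bq⁻¹ * a⁻¹)⁻¹ * g⁻¹⁻¹ := by group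
  rw [h1, Literature.RepresentationTheory.CompactGroups.CompactGroup.trace_conj_eq,
    Literature.RepresentationTheory.CompactGroups.CompactGroup.re_trace_map_inv ρ hρ]

end Geometry

/-! ## §2 Plaquettes and the boundary Wilson action under `Θ` -/

section Action

variable {G : Type} [Group G]

/-- The reflected plaquette: a temporal plaquette `(x; 0, j)` goes to `(θx − e₀; 0, j)`, a spatial one `(x; i, j)` to `(θx; i, j)`
(written as a function of `p : ZdPlaquette 4`). [folklore] -/
theorem reflectPlaq_reflectPlaq (p : ZdPlaquette 4) :
    (fun p : ZdPlaquette 4 => ((if p.2.1.1 = 0 then siteReflect p.1 - Pi.single 0 1 else siteReflect p.1), p.2))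
      ((fun p : ZdPlaquette 4 => ((if p.2.1.1 = 0 then siteReflect p.1 - Pi.single 0 1 else siteReflect p.1), p.2)) p) = p := by
  obtain ⟨x, q⟩ := p
  by_cases h : q.1.1 = 0
  · simp only [h, ↓reduceIte, siteReflect_sub_single_zero, siteReflect_siteReflect, add_sub_cancel_right]
  · simp only [h, ↓reduceIte, siteReflect_siteReflect]

/-- **The edges of the reflected plaquette are the reflected edges.** [folklore] -/
theorem reflectEdge_mem_plaquetteEdges {p : ZdPlaquette 4} {e : Literature.MathematicalPhysics.QuantumLattice.ZdEdge 4}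
    (he : e ∈ plaquetteEdges p) :
    reflectEdge e ∈ plaquetteEdges ((if p.2.1.1 = 0 then siteReflect p.1 - Pi.single 0 1 else siteReflect p.1), p.2) := by
  obtain ⟨x, ⟨⟨i, j⟩, hij⟩⟩ := p
  have hj : j ≠ 0 := fun h => by subst h; exact (Fin.not_lt_zero i) hij
  simp only [plaquetteEdges, Finset.mem_insert, Finset.mem_singleton] at he ⊢
  by_cases hi : i = 0
  · subst hi
    simp only [↓reduceIte]
    rcases he with rfl | rfl | rfl | rfl
    · left; simp [reflectEdge]
    · right; right; right; simp [reflectEdge, siteReflect_add_single_zero, hj]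
    · right; right; left
      simp only [reflectEdge, ↓reduceIte, siteReflect_add_single_of_ne _ hj, Prod.mk.injEq, and_true]
      abel
    · right; left; simp [reflectEdge, hj]
  · simp only [hi, ↓reduceIte]
    rcases he with rfl | rfl | rfl | rfl
    · left; simp [reflectEdge, hi]
    · right; left; simp [reflectEdge, hj, siteReflect_add_single_of_ne _ hi]
    · right; right; left; simp [reflectEdge, hi, siteReflect_add_single_of_ne _ hj]
    · right; right; right; simp [reflectEdge, hj]

/-- `Λ ↦ θΛ ↦ θθΛ = Λ` for finite edge sets. [folklore] -/
theorem map_reflectEdge_map_reflectEdge (Λ : Finset (Literature.MathematicalPhysics.QuantumLattice.ZdEdge 4)) :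
    (Λ.map reflectEdge_involutive.toPerm.toEmbedding).map reflectEdge_involutive.toPerm.toEmbedding = Λ := by
  ext e
  simp only [Finset.mem_map_equiv, Function.Involutive.toPerm_symm, Function.Involutive.coe_toPerm, reflectEdge_reflectEdge]

/-- A plaquette touching `Λ` reflects to a plaquette touching `θΛ`. [folklore] -/
theorem reflectPlaq_mem_plaquettesTouching {Λ : Finset (Literature.MathematicalPhysics.QuantumLattice.ZdEdge 4)} {p : ZdPlaquette 4}
    (hp : p ∈ plaquettesTouching Λ) :
    ((if p.2.1.1 = 0 then siteReflect p.1 - Pi.single 0 1 else siteReflect p.1), p.2) ∈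
      plaquettesTouching (Λ.map reflectEdge_involutive.toPerm.toEmbedding) := by
  rw [mem_plaquettesTouching_iff] at hp ⊢
  obtain ⟨e, he⟩ := hp
  rw [Finset.mem_inter] at he
  refine ⟨reflectEdge e, Finset.mem_inter.2 ⟨reflectEdge_mem_plaquetteEdges he.1, ?_⟩⟩
  rw [Finset.mem_map_equiv, Function.Involutive.toPerm_symm, Function.Involutive.coe_toPerm, reflectEdge_reflectEdge]
  exact he.2

variable {N : ℕ} (ρ : G →* Matrix (Fin N) (Fin N) ℂ) [TopologicalSpace G] [IsTopologicalGroup G] [CompactSpace G]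

/-- **Plaquette observables of `ΘU` are those of `U` at the reflected plaquette.** [cite: OsterwalderSeiler1978, §2] -/
theorem plaquetteObs_cfgReflect (hρ : Continuous ρ) (p : ZdPlaquette 4) (U : LGConfig 4 G) :
    plaquetteObs ρ p.1 p.2.1.1 p.2.1.2 (cfgReflect U) =
      plaquetteObs ρ (if p.2.1.1 = 0 then siteReflect p.1 - Pi.single 0 1 else siteReflect p.1) p.2.1.1 p.2.1.2 U := by
  obtain ⟨x, ⟨⟨i, j⟩, hij⟩⟩ := p
  have hj : j ≠ 0 := fun h => by subst h; exact (Fin.not_lt_zero i) hij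
  by_cases hi : i = 0
  · subst hi
    simp only [↓reduceIte]
    exact plaquetteObs_cfgReflect_temporal ρ hρ hj x U
  · simp only [hi, ↓reduceIte]
    exact plaquetteObs_cfgReflect_spatial ρ hi hj x U

/-- **The boundary Wilson action is reflection covariant**: `S_{θΛ}(ΘU) = S_Λ(U)`. [cite: OsterwalderSeiler1978, §2] -/
theorem wilsonBoundaryAction_cfgReflect (hρ : Continuous ρ) (Λ : Finset (Literature.MathematicalPhysics.QuantumLattice.ZdEdge 4))
    (U : LGConfig 4 G) :
    wilsonBoundaryAction ρ (Λ.map reflectEdge_involutive.toPerm.toEmbedding) (cfgReflect U) = wilsonBoundaryAction ρ Λ U := by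
  unfold wilsonBoundaryAction
  symm
  refine Finset.sum_nbij' (fun p : ZdPlaquette 4 => ((if p.2.1.1 = 0 then siteReflect p.1 - Pi.single 0 1 else siteReflect p.1), p.2))
    (fun p : ZdPlaquette 4 => ((if p.2.1.1 = 0 then siteReflect p.1 - Pi.single 0 1 else siteReflect p.1), p.2))
    (fun p hp => reflectPlaq_mem_plaquettesTouching hp) (fun p hp => ?_) (fun p _ => reflectPlaq_reflectPlaq p)
    (fun p _ => reflectPlaq_reflectPlaq p) (fun p _ => ?_)
  · have h := reflectPlaq_mem_plaquettesTouching hp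
    rwa [map_reflectEdge_map_reflectEdge] at h
  · rw [plaquetteObs_cfgReflect ρ hρ _ U]
    congr 2
    have h := reflectPlaq_reflectPlaq p
    simp only at h
    obtain ⟨x, q⟩ := p
    simp only [Prod.mk.injEq] at h ⊢
    exact h.1.symm

end Action

/-! ## §3 The kernels under `Θ`: transport of product Haar measure, tilting, and the covariance theorem -/

section Kernel

/-- Tilting commutes with push-forward (change of variables in the density and its normalisation; the tree's private
`LatticeGaugeDLRSymmetry.tilted_comp_map`, restated for use here). [folklore] -/
theorem tilted_comp_map' {α γ : Type*} [MeasurableSpace α] [MeasurableSpace γ] (μ : Measure α)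
    {Ψ : α → γ} (hΨ : Measurable Ψ) {g : γ → ℝ} (hg : Measurable g) :
    (μ.tilted (g ∘ Ψ)).map Ψ = (μ.map Ψ).tilted g := by
  have hexp : Measurable fun y => Real.exp (g y) := Real.measurable_exp.comp hg
  have hC : ∫ y, Real.exp (g y) ∂(μ.map Ψ) = ∫ x, Real.exp ((g ∘ Ψ) x) ∂μ := by
    rw [integral_map hΨ.aemeasurable hexp.aestronglyMeasurable]; rfl
  ext s hs
  have hdens : Measurable fun y =>
      ENNReal.ofReal (Real.exp (g y) / ∫ x, Real.exp (g x) ∂(μ.map Ψ)) :=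
    ENNReal.measurable_ofReal.comp (hexp.div_const _)
  rw [Measure.map_apply hΨ hs, Measure.tilted, Measure.tilted, withDensity_apply _ (hΨ hs),
    withDensity_apply _ hs, setLIntegral_map hs hdens hΨ, hC]
  rfl

variable {G : Type} [Group G] [TopologicalSpace G] [IsTopologicalGroup G] [CompactSpace G]
  [MeasurableSpace G] [BorelSpace G]

/-- Membership transport: `e' ∈ θΛ ↔ θe' ∈ Λ`. [folklore] -/
theorem reflectEdge_mem_of_mem_map {Λ : Finset (Literature.MathematicalPhysics.QuantumLattice.ZdEdge 4)}
    {e' : Literature.MathematicalPhysics.QuantumLattice.ZdEdge 4} (he' : e' ∈ Λ.map reflectEdge_involutive.toPerm.toEmbedding) :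
    reflectEdge e' ∈ Λ := by
  rw [Finset.mem_map_equiv, Function.Involutive.toPerm_symm, Function.Involutive.coe_toPerm] at he'
  exact he'

omit [TopologicalSpace G] [IsTopologicalGroup G] [CompactSpace G] [BorelSpace G] in
/-- **`Θ` intertwines the gluing maps**: `Θ(ζ η_{Λᶜ}) = (Tζ) (Θη)_{(θΛ)ᶜ}` with the transport `T : G^Λ → G^{θΛ}`,
`(Tζ)(e') = ζ(θe')` on spatial and `ζ(θe')⁻¹` on temporal edges (relabelling followed by inversion of the temporal coordinates). [folklore] -/
theorem cfgReflect_glueWith (Λ : Finset (Literature.MathematicalPhysics.QuantumLattice.ZdEdge 4)) (η : LGConfig 4 G) (ζ : ↥Λ → G) :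
    cfgReflect (glueWith Λ ζ η) =
      glueWith (Λ.map reflectEdge_involutive.toPerm.toEmbedding)
        ((fun (ζ' : ↥(Λ.map reflectEdge_involutive.toPerm.toEmbedding) → G) (e' : ↥(Λ.map reflectEdge_involutive.toPerm.toEmbedding)) =>
            if e'.1.2 = 0 then (ζ' e')⁻¹ else ζ' e')
          (MeasurableEquiv.piCongrLeft (fun _ => G) (finsetRelabel reflectEdge_involutive.toPerm Λ) ζ))
        (cfgReflect η) := by
  have hP : ∀ e' : ↥(Λ.map reflectEdge_involutive.toPerm.toEmbedding),
      MeasurableEquiv.piCongrLeft (fun _ => G) (finsetRelabel reflectEdge_involutive.toPerm Λ) ζ e' =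
        ζ ⟨reflectEdge e', reflectEdge_mem_of_mem_map e'.2⟩ := by
    intro e'
    rw [MeasurableEquiv.coe_piCongrLeft, Equiv.piCongrLeft_apply_eq_cast, cast_eq]
    rfl
  funext e
  rw [cfgReflect_apply]
  by_cases he : reflectEdge e ∈ Λ
  · have he' : e ∈ Λ.map reflectEdge_involutive.toPerm.toEmbedding := by
      rw [Finset.mem_map_equiv, Function.Involutive.toPerm_symm, Function.Involutive.coe_toPerm]; exact he
    rw [glueWith_apply_mem _ _ _ he, glueWith_apply_mem _ _ _ he']
    beta_reduce
    rw [hP]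
  · have he' : e ∉ Λ.map reflectEdge_involutive.toPerm.toEmbedding := fun h => he (reflectEdge_mem_of_mem_map h)
    rw [glueWith_apply_not_mem _ _ _ he, glueWith_apply_not_mem _ _ _ he', cfgReflect_apply]

/-- **The transport `T` preserves product Haar measure** (relabelling: `measurePreserving_piCongrLeft`; coordinatewise inversion on
the temporal edges: inversion invariance of Haar measure on the compact group). [folklore] -/
theorem measurePreserving_reflectTransport (Λ : Finset (Literature.MathematicalPhysics.QuantumLattice.ZdEdge 4)) :
    MeasurePreserving
      ((fun (ζ' : ↥(Λ.map reflectEdge_involutive.toPerm.toEmbedding) → G) (e' : ↥(Λ.map reflectEdge_involutive.toPerm.toEmbedding)) =>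
          if e'.1.2 = 0 then (ζ' e')⁻¹ else ζ' e') ∘
        MeasurableEquiv.piCongrLeft (fun _ => G) (finsetRelabel reflectEdge_involutive.toPerm Λ))
      (Measure.pi fun _ : ↥Λ => haarProbability G)
      (Measure.pi fun _ : ↥(Λ.map reflectEdge_involutive.toPerm.toEmbedding) => haarProbability G) := by
  haveI : IsFiniteMeasure (haarProbability G) := by unfold haarProbability; infer_instance
  have hP := measurePreserving_piCongrLeft (fun _ : ↥(Λ.map reflectEdge_involutive.toPerm.toEmbedding) => haarProbability G)
    (finsetRelabel reflectEdge_involutive.toPerm Λ)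
  have hJ : MeasurePreserving
      (fun (ζ' : ↥(Λ.map reflectEdge_involutive.toPerm.toEmbedding) → G) (e' : ↥(Λ.map reflectEdge_involutive.toPerm.toEmbedding)) =>
        if e'.1.2 = 0 then (ζ' e')⁻¹ else ζ' e')
      (Measure.pi fun _ : ↥(Λ.map reflectEdge_involutive.toPerm.toEmbedding) => haarProbability G)
      (Measure.pi fun _ : ↥(Λ.map reflectEdge_involutive.toPerm.toEmbedding) => haarProbability G) := by
    refine measurePreserving_pi _ _
      (f := fun (e' : ↥(Λ.map reflectEdge_involutive.toPerm.toEmbedding)) (g : G) => if e'.1.2 = 0 then g⁻¹ else g) fun e' => ?_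
    by_cases h : e'.1.2 = 0
    · simp only [h, ↓reduceIte]
      exact Measure.measurePreserving_inv _
    · simp only [h, ↓reduceIte]
      exact MeasurePreserving.id _
  exact hJ.comp hP

variable (r : LatticeRep G)

/-- **Covariance of the lattice Yang–Mills kernels under the time reflection**: `Θ_* γ_Λ(· | η) = γ_{θΛ}(· | Θη)`.
[cite: Georgii2011, §5.1 (5.6)–(5.8)] -/
theorem ymSpecification_map_cfgReflect (β : ℝ) (Λ : Finset (Literature.MathematicalPhysics.QuantumLattice.ZdEdge 4)) (η : LGConfig 4 G) :
    (ymSpecification r.ρ β Λ η).map cfgReflect =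
      ymSpecification r.ρ β (Λ.map reflectEdge_involutive.toPerm.toEmbedding) (cfgReflect η) := by
  haveI : SecondCountableTopology G := (Continuous.isClosedEmbedding r.continuous r.injective).isEmbedding.secondCountableTopology
  haveI : IsFiniteMeasure (haarProbability G) := by unfold haarProbability; infer_instance
  set Λ' := Λ.map reflectEdge_involutive.toPerm.toEmbedding with hΛ'
  have hΨ : Measurable (cfgReflect (G := G)) := measurable_cfgReflect
  have hg : Measurable fun U : LGConfig 4 G => -β * wilsonBoundaryAction r.ρ Λ' U :=
    (continuous_const.mul (continuous_wilsonBoundaryAction r.ρ r.continuous _)).measurable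
  have hcomp : (fun U : LGConfig 4 G => -β * wilsonBoundaryAction r.ρ Λ U) =
      (fun U : LGConfig 4 G => -β * wilsonBoundaryAction r.ρ Λ' U) ∘ cfgReflect := by
    funext U
    rw [Function.comp_apply, hΛ', wilsonBoundaryAction_cfgReflect r.ρ r.continuous]
  have hT := measurePreserving_reflectTransport (G := G) Λ
  have hglue : (cfgReflect ∘ fun ζ : ↥Λ → G => glueWith Λ ζ η) =
      (fun ζ' : ↥Λ' → G => glueWith Λ' ζ' (cfgReflect η)) ∘
        ((fun (ζ' : ↥Λ' → G) (e' : ↥Λ') => if e'.1.2 = 0 then (ζ' e')⁻¹ else ζ' e') ∘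
          MeasurableEquiv.piCongrLeft (fun _ => G) (finsetRelabel reflectEdge_involutive.toPerm Λ)) := by
    funext ζ
    exact cfgReflect_glueWith Λ η ζ
  unfold ymSpecification
  rw [hcomp, tilted_comp_map' _ hΨ hg, Measure.map_map hΨ (measurable_glueWith Λ η), hglue,
    ← Measure.map_map (measurable_glueWith Λ' (cfgReflect η)) hT.measurable, hT.map_eq]

/-- **Reflection covariance of the cube kernels**: `kerE^{Θη}_{θ-box}(F) = kerE^η_{box}(F ∘ Θ)`, stated with the interior edge set
`cubeEdges c b` and its reflected image. [folklore] -/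
theorem integral_ymSpecification_cfgReflect (β : ℝ) (Λ : Finset (Literature.MathematicalPhysics.QuantumLattice.ZdEdge 4))
    (η : LGConfig 4 G) {F : LGConfig 4 G → ℝ} (hF : Measurable F) :
    ∫ U, F U ∂(ymSpecification r.ρ β (Λ.map reflectEdge_involutive.toPerm.toEmbedding) (cfgReflect η)) =
      ∫ U, (F ∘ cfgReflect) U ∂(ymSpecification r.ρ β Λ η) := by
  rw [← ymSpecification_map_cfgReflect r β Λ η, integral_map measurable_cfgReflect.aemeasurable hF.aestronglyMeasurable]
  rfl

/-- **Hypothesis (S) of the orbit test for a reflection-symmetric box**: if the time reflection maps the interior edge set of the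
box onto itself (`(cubeEdges c b).map θ = cubeEdges c b`, i.e. the box is symmetric about the time-zero hyperplane in the lattice
convention of `Θ`) and fixes the exterior (`Θη = η`), then `kerE^η_β(F ∘ Θ) = kerE^η_β(F)` for every measurable `F`. [folklore] -/
theorem kerE_cfgReflect_symm (β : ℝ) {c : Fin 4 → ℤ} {b : ℕ}
    (hΛ : (cubeEdges c b).map reflectEdge_involutive.toPerm.toEmbedding = cubeEdges c b) {η : LGConfig 4 G}
    (hη : cfgReflect η = η) {F : LGConfig 4 G → ℝ} (hF : Measurable F) :
    kerE G r β c b η (F ∘ cfgReflect) = kerE G r β c b η F := by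
  unfold kerE
  rw [← integral_ymSpecification_cfgReflect r β (cubeEdges c b) η hF, hΛ, hη]

end Kernel

end Summit.QuantumFields.YangMills.Cruxes.NT.ClassicalShadow

end
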